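import Literature.IUT.HodgeArakelov.GMonoidFrobenioids
import Literature.IUT.HodgeArakelov.TemperedThetaMonoidsDef38DivisorInvariantsProofs
import Literature.AlgebraicGeometry.Frobenioids.ModelFrobenioidStandard
import Literature.AlgebraicGeometry.Frobenioids.ElementaryPreFrobenioid
import Literature.AlgebraicGeometry.Frobenioids.ElementaryFrobeniusCompact
import Literature.AlgebraicGeometry.Frobenioids.MonoidsCharacteristicTypeAutomatic
import Literature.AlgebraicGeometry.Frobenioids.MonoidTransport
import Literature.AlgebraicGeometry.Frobenioids.PadicFrobenioidUnitGroups
import Literature.AlgebraicGeometry.Frobenioids.ArithmeticFrobenioidIsotropic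
import Literature.AnabelianGeometry.SemiGraphs.CosetCategoriesFSM
import HarnessLib

/-!
# [IUTchII] Definition 3.8 (ii) — proof companion of `GMonoidFrobenioids.lean`: the model Frobenioid of a split
# `G`-monoid `U·θ^ℕ` satisfies the hypotheses of [FrdI] Thm 5.2, and its divisor monoid is `ℕ` at EVERY object

S. Mochizuki, *Inter-universal Teichmüller theory II*, §3, kurims Dec-2020 manuscript, Definition 3.8 (ii) p. 113
l. 40–52: «Each of the monoids equipped with a topological group action `G_v(M^Θ_*▶) ↷ Ψ^ι_env(M^Θ_*)`;
`G_v(M^Θ_*▶) ↷ Ψ_{†F^Θ_v,α}`; `G_v(M^Θ_*▶)_⟨F_l^⋇⟩ ↷ Ψ_ξ(M^Θ_*)`; `G_v(M^Θ_*)_⟨F_l^⋇⟩ ↷ Ψ_{F_ξ}(†F_v)` … gives rise to a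
`p_v`-adic Frobenioid of monoid type `ℤ` [cf. [FrdII], Example 1.1, (ii)] … whose divisor monoid associates to every object
of `B^temp(G_v(−))⁰` … a monoid isomorphic to `ℕ`» [cite: Mochizuki2012, Def 3.8 (ii) p.113]; [FrdI] Thm 5.2 hypotheses («`Φ` a
divisorial monoid on a connected, totally epimorphic category `D`, `B` a group-like monoid on `D`») [cite: MochizukiFrdI2008, Thm 5.2 p.100].
Claim key DISPUTED (D-0012): nothing of [IUTchII] is asserted. abc-iut cell, layer L6, residual **R-Def38-a**, part (B) (L6-lead
GO 13:57:45Z, §F v1.19aw (3) / v1.19ax (2); abc-iut-L1-lead's interface condition (2) «`gives rise to a Frobenioid` is honest only if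
you ALSO discharge `ModelFrobenioid.Hypotheses Φ B`»). PROOF-ONLY: 0 `def`/`structure`/`instance`, no new `Prop` fact.
WHAT IS PROVED, for the `G`-monoid `M := CoveringMonoid.ofStable ρ (U·θ^ℕ) _` cut out of a `G`-module `ρ : G → Aut(H)` by
a split monoid `U·θ^ℕ` (`TemperedThetaMonoids.splitMonoid U (powers θ)`: the shape of `Ψ^ι_env = M^×_TM·θ^ℕ` (Prop 3.1 (i)),
`Ψ_{†F^Θ_v,α} = O^×·(Θ^α_v)^ℕ` (Ex 3.2 (i)), `Ψ_ξ`, `Ψ_{F_ξ}` (Cor 3.5 (ii)/3.6 (ii))) under the PRINTED stabiliser hypotheses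
«`U` `G`-stable, `θ` `G`-fixed» and «`θ` non-torsion modulo `U`» (inputs of Cor 3.5 (ii), BY NAME at each instance):
`exists_associates_invariants_equiv_nat` — **«divisor monoid ≅ ℕ at EVERY object»** (`Associates (Ψ^V) ≃* ℕ`, `[u·θ^n] ↦ n`,
abc-iut-w4-d019 g4's p447942 transported along `Ψ^V ≅ U^{ρ(V)}·θ^ℕ`); `isMonoidOn_{invariants,divisor,ratFn}Functor`,
`isDivisorial_divisorFunctor`, `isGroupLike_ratFnFunctor` and **`hypotheses_ofStable_splitMonoid :
ModelFrobenioid.Hypotheses M.divisorFunctor M.ratFnFunctor`** ([FrdI] Thm 5.2's hypotheses over `CosetCat G` — connected,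
totally epimorphic, monos are isos: abc-iut-L5-t2 / `CosetCategoriesFSM`), so abc-iut-L1's Thm 5.2 theory applies to
`M.frobenioid`. HONEST LIMITS: Def 3.8 (i)'s «`≅ ℚ≥0`» perfected divisor monoid of `F_cns` at the genuine producers is abc-iut-L1's
`PadicFrd.Datum.perf` route (named follow-up); the Frobenioid-level Kummer isomorphisms of (ii) = functoriality of
`ModelFrobenioid` in its data (abc-iut-L1 `ModelFrobenioid.DataHom`) — not re-done; no side taken on [IUTchIII] Cor 3.12;
typed ≠ proved.
-/

namespace Literature.IUT.HodgeArakelov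

namespace CoveringMonoid

open CategoryTheory Opposite Literature.AnabelianGeometry.SemiGraphs Literature.AlgebraicGeometry.Frobenioids
open TemperedThetaMonoids BadPrimeGaussianMonoids

universe u v

/-! ### §1. Base-category and group-like generalities (any `G`-monoid) -/
section Generic

variable {G : Type u} [Group G] [TopologicalSpace G] (M : CoveringMonoid.{u, v} G)

/-- The small base `CosetCat G = B^temp(G)⁰` is connected in [FrdI]'s graph sense (abc-iut-L5-t2's `CosetCat.isConnected`).
[cite: MochizukiFrdI2008, Thm 5.2 p.100] -/
theorem isGraphConnected_cosetCat : IsGraphConnected (CosetCat G) :=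
  isGraphConnected_iff_isConnected.mpr CosetCat.isConnected

/-- Over `CosetCat G` every FSM-morphism is an isomorphism (abc-iut-L5-t2's `CosetCat.isIso_of_mono`), so EVERY monoid
functor pulls FSM-morphisms back to bijections ([FrdI] Def 1.1 (ii)(b)). [cite: MochizukiFrdI2008, Def. 1.1(ii) p.19] -/
theorem bijective_pull_of_isFSM [IsTopologicalGroup G] (Φ : (CosetCat G)ᵒᵖ ⥤ CommMonCat.{v})
    {A B : CosetCat G} (α : B ⟶ A) (hα : IsFSM α) :
    Function.Bijective (Literature.AlgebraicGeometry.Frobenioids.pull Φ α) := by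
  haveI := hα.2
  haveI : IsIso α := CosetCat.isIso_of_mono α
  change Function.Bijective (Φ.map α.op).hom
  refine Function.bijective_iff_has_inverse.mpr ⟨(inv (Φ.map α.op)).hom, fun x => ?_, fun y => ?_⟩
  · change (Φ.map α.op ≫ inv (Φ.map α.op)).hom x = x
    rw [IsIso.hom_inv_id]
    rfl
  · change (inv (Φ.map α.op) ≫ Φ.map α.op).hom y = y
    rw [IsIso.inv_hom_id]
    rfl

/-- The rational-function monoid `B(G/U) = (Ψ^U)^gp` is group-like at every object ([FrdI] Def 1.1 (i); abc-iut-L1's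
`isGroupLike_of_commGroup`). [cite: MochizukiFrdI2008, Thm 5.2 p.100] -/
theorem isGroupLike_ratFnFunctor : Objectwise (fun X _ => IsGroupLike X) M.ratFnFunctor := fun X =>
  isGroupLike_of_commGroup (Algebra.GrothendieckGroup (M.invariants (X.sg : Subgroup G)))

omit [TopologicalSpace G] in
/-- The invariants monoids `Ψ^U ⊆ O` of a `G`-monoid with CANCELLATIVE `O` are cancellative.
[cite: MochizukiFrdI2008, §0 p.11] -/
theorem isCancelMul_invariants [IsCancelMul M.O] (U : Subgroup G) : IsCancelMul (M.invariants U) :=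
  Subtype.coe_injective.isCancelMul _ (fun _ _ => rfl)

/-- If `O` is cancellative and every pull-back `Ψ^V → Ψ^U` is injective on divisor classes, then `G/U ↦ Ψ^U` is a monoid on
`CosetCat G` ([FrdI] Def 1.1 (ii): (a) characteristically injective pull-backs — injectivity itself is automatic, the action
of a group element being injective; (b) FSM-morphisms pull back to bijections — automatic over `CosetCat G`).
[cite: MochizukiFrdI2008, Def. 1.1(ii) p.19] -/
theorem isMonoidOn_invariantsFunctor_of [IsTopologicalGroup G]
    (hchar : ∀ {A B : CosetCat G} (α : B ⟶ A), Function.Injective (associatesMap (M.pull α))) :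
    IsMonoidOn M.invariantsFunctor := by
  refine ⟨fun {A B} α => ⟨?_, hchar α⟩, fun {A B} α hα => bijective_pull_of_isFSM M.invariantsFunctor α hα⟩
  -- injectivity of `Ψ^V → Ψ^U`, `x ↦ a·x`
  intro x y hxy
  apply Subtype.ext
  have h := congrArg Subtype.val hxy
  change (M.pull α x : M.O) = (M.pull α y : M.O) at h
  rw [M.coe_pull_eq_act α (rep_spec α), M.coe_pull_eq_act α (rep_spec α)] at h
  exact (M.act (rep α)).injective h

/-- Under the same hypothesis the DIVISOR monoid `Φ = Ψ/Ψ^×` is a monoid on `CosetCat G` (abc-iut-L1's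
`isMonoidOn_charFunctor`). [cite: MochizukiFrdI2008, Def. 1.1(ii) p.19] -/
theorem isMonoidOn_divisorFunctor_of [IsTopologicalGroup G]
    (hchar : ∀ {A B : CosetCat G} (α : B ⟶ A), Function.Injective (associatesMap (M.pull α))) :
    IsMonoidOn M.divisorFunctor :=
  isMonoidOn_charFunctor (M.isMonoidOn_invariantsFunctor_of hchar)

/-- For cancellative `O`, the rational-function monoid `B = (Ψ)^gp` is a monoid on `CosetCat G`: the groupified pull-backs are
injective (abc-iut-L1's `MonGp.map_injective`) and characteristically injective because `B(G/U)` is a group.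
[cite: MochizukiFrdI2008, Def. 1.1(ii) p.19] -/
theorem isMonoidOn_ratFnFunctor [IsTopologicalGroup G] [IsCancelMul M.O] : IsMonoidOn M.ratFnFunctor := by
  refine ⟨fun {A B} α => ⟨?_, ?_⟩, fun {A B} α hα => bijective_pull_of_isFSM M.ratFnFunctor α hα⟩
  · haveI : IsCancelMul (M.invariants (B.sg : Subgroup G)) := M.isCancelMul_invariants _
    change Function.Injective (MonGp.map (M.pull α))
    refine MonGp.map_injective _ fun x y hxy => Subtype.ext ?_
    have h := congrArg Subtype.val hxy
    change (M.pull α x : M.O) = (M.pull α y : M.O) at h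
    rw [M.coe_pull_eq_act α (rep_spec α), M.coe_pull_eq_act α (rep_spec α)] at h
    exact (M.act (rep α)).injective h
  · haveI : Subsingleton (Associates (M.ratFnFunctor.obj (op A))) :=
      (M.isGroupLike_ratFnFunctor A).subsingleton_associates
    exact Function.injective_of_subsingleton _

end Generic

/-! ### §2. The split `G`-monoid `U·θ^ℕ`: stability, invariants, divisor monoid `ℕ` at every object -/
section Split

variable {G : Type u} [Group G] {H : Type v} [CommGroup H] (ρ : G →* MulAut H) (U : Subgroup H) (θ : H)

/-- `U·θ^ℕ` is `ρ`-stable when `U` is `ρ`-stable and `θ` is `ρ`-fixed («compatible with the respective conjugation actions»,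
[IUTchII] Prop 3.1 (i) / Ex 3.2 (i) / Cor 3.5 (ii)). [cite: Mochizuki2012, Def 3.8 (ii) p.113] -/
theorem splitMonoid_stable (hU : ∀ (g : G) (x : H), x ∈ U → ρ g x ∈ U) (hθ : ∀ g : G, ρ g θ = θ) :
    ∀ (g : G) (x : H), x ∈ splitMonoid U (Submonoid.powers θ) → ρ g x ∈ splitMonoid U (Submonoid.powers θ) := by
  intro g x hx
  obtain ⟨u, hu, _, ⟨n, rfl⟩, rfl⟩ := (mem_splitMonoid_iff _ _ _).mp hx
  rw [map_mul, map_pow, hθ]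
  exact (mem_splitMonoid_iff _ _ _).mpr ⟨ρ g u, hU g u hu, θ ^ n, ⟨n, rfl⟩, rfl⟩

variable (hU : ∀ (g : G) (x : H), x ∈ U → ρ g x ∈ U) (hθ : ∀ g : G, ρ g θ = θ)

/-- The `ρ(V)`-fixed part `U^V := U ⊓ ⨅_{v ∈ V} Fix(ρ v)` of `U`, spelt with abc-iut-w4-d019 g4's fixed-subgroup family at
`Φ := ρ '' V`: membership. [cite: Mochizuki2012, Def 3.8 (ii) p.113] -/
theorem mem_fixedUnits_iff (V : Subgroup G) (u : H) :
    u ∈ U ⊓ ⨅ φ ∈ (fun v : G => (ρ v : H ≃* H)) '' (V : Set G), MonoidHom.eqLocus φ.toMonoidHom (MonoidHom.id H) ↔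
      u ∈ U ∧ ∀ v ∈ V, ρ v u = u := by
  rw [Subgroup.mem_inf]
  refine and_congr_right fun _ => ?_
  constructor
  · intro h v hv
    have h1 := Subgroup.mem_iInf.mp (Subgroup.mem_iInf.mp h (ρ v : H ≃* H)) ⟨v, hv, rfl⟩
    exact h1
  · intro h
    refine Subgroup.mem_iInf.mpr fun φ => Subgroup.mem_iInf.mpr fun hφ => ?_
    obtain ⟨v, hv, rfl⟩ := hφ
    exact h v hv

/-- **Invariants of the split `G`-monoid**: `x ∈ U·θ^ℕ` is `ρ(V)`-invariant iff `x ∈ U^V·θ^ℕ` (abc-iut-w4-d019 g4's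
`mem_splitMonoid_and_fixed_iff` at the family `ρ '' V`). [cite: Mochizuki2012, Def 3.8 (ii) p.113] -/
theorem mem_invariants_split_iff (V : Subgroup G) (x : splitMonoid U (Submonoid.powers θ)) :
    x ∈ (ofStable ρ (splitMonoid U (Submonoid.powers θ)) (splitMonoid_stable ρ U θ hU hθ)).invariants V ↔
      (x : H) ∈ splitMonoid (U ⊓ ⨅ φ ∈ (fun v : G => (ρ v : H ≃* H)) '' (V : Set G),
        MonoidHom.eqLocus φ.toMonoidHom (MonoidHom.id H)) (Submonoid.powers θ) := by
  rw [mem_invariants_ofStable_iff,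
    ← mem_splitMonoid_and_fixed_iff U θ ((fun v : G => (ρ v : H ≃* H)) '' (V : Set G)) ?_ (x : H)]
  · constructor
    · intro h
      refine ⟨x.2, fun φ hφ => ?_⟩
      obtain ⟨v, hv, rfl⟩ := hφ
      exact h v hv
    · rintro ⟨_, h⟩ v hv
      exact h (ρ v : H ≃* H) ⟨v, hv, rfl⟩
  · rintro φ ⟨v, _, rfl⟩
    exact hθ v

/-- **IUTchII:Def3.8(ii) «whose divisor monoid associates to EVERY object of `B^temp(G_v(−))⁰` a monoid isomorphic to `ℕ`»** —
PROVED for the Frobenioid `(ofStable ρ (U·θ^ℕ) _).frobenioid` of `GMonoidFrobenioids.lean`: at every object `G/V` the divisor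
monoid `Φ(G/V) = Ψ^V/(Ψ^V)^×` is `(ℕ, +)`, the class of `u·θ^n` (`u ∈ U^V`) going to `n`, granted «`θ` non-torsion modulo `U`».
[cite: Mochizuki2012, Def 3.8 (ii) p.113] -/
theorem exists_associates_invariants_equiv_nat (hfree : ∀ n : ℕ, θ ^ n ∈ U → n = 0) (V : Subgroup G) :
    ∃ d : Associates ((ofStable ρ (splitMonoid U (Submonoid.powers θ)) (splitMonoid_stable ρ U θ hU hθ)).invariants V) ≃*
        Multiplicative ℕ,
      ∀ (x : (ofStable ρ (splitMonoid U (Submonoid.powers θ)) (splitMonoid_stable ρ U θ hU hθ)).invariants V)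
        (u : H) (n : ℕ), u ∈ U → ((x : splitMonoid U (Submonoid.powers θ)) : H) = u * θ ^ n →
        d (Associates.mk x) = Multiplicative.ofAdd n := by
  classical
  set M := ofStable ρ (splitMonoid U (Submonoid.powers θ)) (splitMonoid_stable ρ U θ hU hθ) with hM
  set UV : Subgroup H := U ⊓ ⨅ φ ∈ (fun v : G => (ρ v : H ≃* H)) '' (V : Set G),
    MonoidHom.eqLocus φ.toMonoidHom (MonoidHom.id H) with hUV
  -- the tautological isomorphism `Ψ^V ≃* U^V·θ^ℕ`, `x ↦ x`
  let e : M.invariants V ≃* splitMonoid UV (Submonoid.powers θ) :=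
    { toFun := fun x => ⟨((x : splitMonoid U (Submonoid.powers θ)) : H),
        (mem_invariants_split_iff ρ U θ hU hθ V x.1).mp x.2⟩
      invFun := fun y => ⟨⟨(y : H),
          (sup_le_sup_right (Subgroup.toSubmonoid_le.mpr (inf_le_left : UV ≤ U)) (Submonoid.powers θ)) y.2⟩,
        (mem_invariants_split_iff ρ U θ hU hθ V _).mpr y.2⟩
      left_inv := fun x => rfl
      right_inv := fun y => rfl
      map_mul' := fun x y => rfl }
  obtain ⟨d₀, hd₀⟩ := exists_associates_fixed_splitMonoid_equiv_nat U θ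
    ((fun v : G => (ρ v : H ≃* H)) '' (V : Set G)) hfree
  obtain ⟨c, hc⟩ := exists_associates_equiv_of_mulEquiv e
  refine ⟨c.trans d₀, fun x u n hu hx => ?_⟩
  have hxUV : u ∈ UV := by
    -- `x = u·θ^n` is `ρ(V)`-fixed and `θ` is fixed, so `u` is fixed
    have hx' : ((x : splitMonoid U (Submonoid.powers θ)) : H) ∈ splitMonoid UV (Submonoid.powers θ) :=
      (mem_invariants_split_iff ρ U θ hU hθ V x.1).mp x.2
    rw [hx] at hx'
    obtain ⟨u', hu', _, ⟨m, rfl⟩, h⟩ := (mem_splitMonoid_iff _ _ _).mp hx'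
    -- uniqueness of the decomposition `u'·θ^m = u·θ^n`
    have hmn : m = n := by
      rcases Nat.lt_or_ge m n with hlt | hge
      · exfalso
        have : θ ^ (n - m) ∈ U := by
          have h2 : u' = u * θ ^ (n - m) := by
            have h3 : u' * θ ^ m = u * θ ^ (n - m) * θ ^ m := by
              rw [h, mul_assoc, ← pow_add, Nat.sub_add_cancel hlt.le]
            exact mul_right_cancel h3
          have h4 : θ ^ (n - m) = u⁻¹ * u' := by rw [h2, inv_mul_cancel_left]
          rw [h4]
          exact U.mul_mem (U.inv_mem hu) (Subgroup.mem_inf.mp hu').1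
        have h5 := hfree _ this
        omega
      · have : θ ^ (m - n) ∈ U := by
          have h2 : u = u' * θ ^ (m - n) := by
            have h3 : u * θ ^ n = u' * θ ^ (m - n) * θ ^ n := by
              rw [← h, mul_assoc, ← pow_add, Nat.sub_add_cancel hge]
            exact mul_right_cancel h3
          have h4 : θ ^ (m - n) = u'⁻¹ * u := by rw [h2, inv_mul_cancel_left]
          rw [h4]
          exact U.mul_mem (U.inv_mem (Subgroup.mem_inf.mp hu').1) hu
        have h5 := hfree _ this
        omega
    rw [hmn] at h
    have hu'u : u' = u := mul_right_cancel h
    rw [← hu'u]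
    exact hu'
  rw [MulEquiv.trans_apply, hc]
  have he : e x = ⟨u * θ ^ n, mul_pow_mem_thetaSplit UV θ hxUV n⟩ := Subtype.ext hx
  rw [he]
  exact hd₀ u hxUV n

/-- The invariants monoids `Ψ^V` of the split `G`-monoid are pre-divisorial ([FrdI] Def 1.1 (i): integral — a submonoid of
the group `H`; saturated — through `Ψ^V/(Ψ^V)^× ≅ ℕ` and abc-iut-L1's `isSaturated_iff_associates`; of characteristic type —
automatic, erratum (30)). [cite: MochizukiFrdI2008, Def. 1.1(i) p.19] -/
theorem isPreDivisorial_invariants (hfree : ∀ n : ℕ, θ ^ n ∈ U → n = 0) (V : Subgroup G) :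
    IsPreDivisorial ((ofStable ρ (splitMonoid U (Submonoid.powers θ)) (splitMonoid_stable ρ U θ hU hθ)).invariants V) := by
  set M := ofStable ρ (splitMonoid U (Submonoid.powers θ)) (splitMonoid_stable ρ U θ hU hθ) with hM
  haveI : IsCancelMul M.O := Subtype.coe_injective.isCancelMul _ (fun _ _ => rfl)
  haveI : IsCancelMul (M.invariants V) := M.isCancelMul_invariants V
  have hint : IsIntegral (M.invariants V) := isIntegral_iff_isCancelMul.mpr inferInstance
  refine isPreDivisorial_of_isIntegral_of_isSaturated hint ?_
  -- saturation: `b^n ∣ a^n ⇒ b ∣ a`, read through the divisor monoid `Associates Ψ^V ≃* (ℕ, +)`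
  obtain ⟨d, _⟩ := exists_associates_invariants_equiv_nat ρ U θ hU hθ hfree V
  refine isSaturated_of_dvd_of_pow_dvd_pow fun a b n hn hab => ?_
  have h1 : Associates.mk b ^ n ∣ Associates.mk a ^ n := by
    rw [← Associates.mk_pow, ← Associates.mk_pow]
    exact Associates.mk_dvd_mk.mpr hab
  have h2 : d (Associates.mk b) ^ n ∣ d (Associates.mk a) ^ n := by
    rw [← map_pow, ← map_pow]
    exact map_dvd d h1
  have h3 : d (Associates.mk b) ∣ d (Associates.mk a) := by
    obtain ⟨c, hc⟩ := h2
    have hc' := congrArg Multiplicative.toAdd hc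
    simp only [toAdd_mul, toAdd_pow, smul_eq_mul] at hc'
    have h4 : n * (d (Associates.mk b)).toAdd ≤ n * (d (Associates.mk a)).toAdd := by omega
    have h5 := Nat.le_of_mul_le_mul_left h4 hn
    refine ⟨Multiplicative.ofAdd ((d (Associates.mk a)).toAdd - (d (Associates.mk b)).toAdd), ?_⟩
    apply Multiplicative.toAdd.injective
    simp only [toAdd_mul, toAdd_ofAdd]
    omega
  have h6 : Associates.mk b ∣ Associates.mk a := by
    have := map_dvd d.symm h3
    rwa [MulEquiv.symm_apply_apply, MulEquiv.symm_apply_apply] at this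
  exact Associates.mk_dvd_mk.mp h6

/-- The divisor monoids `Ψ^V/(Ψ^V)^×` of the split `G`-monoid are divisorial ([FrdI] Def 1.1 (i), abc-iut-L1's
`IsPreDivisorial.isDivisorial_associates`). [cite: MochizukiFrdI2008, Def. 1.1(i) p.19] -/
theorem isDivisorial_divisorFunctor [TopologicalSpace G] (hfree : ∀ n : ℕ, θ ^ n ∈ U → n = 0) :
    Objectwise (fun X _ => IsDivisorial X)
      (ofStable ρ (splitMonoid U (Submonoid.powers θ)) (splitMonoid_stable ρ U θ hU hθ)).divisorFunctor := fun _ =>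
  (isPreDivisorial_invariants ρ U θ hU hθ hfree _).isDivisorial_associates

/-- **Pull-backs of the split `G`-monoid are injective on divisor classes**: along `G/U' → G/V'` (`1·U' ↦ a·V'`) the map
`Ψ^{V'}/units → Ψ^{U'}/units` is, in the coordinates `[u·θ^n] ↦ n` at both ends, the IDENTITY of `ℕ` — the generator `θ` is
`G`-fixed («monoid type `ℤ`»: no ramification in the `θ`-direction; abc-iut-w4-d019 g4's `fixed_splitMonoid_mono`).
[cite: Mochizuki2012, Def 3.8 (ii) p.113] -/
theorem associatesMap_pull_injective [TopologicalSpace G] (hfree : ∀ n : ℕ, θ ^ n ∈ U → n = 0)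
    {A B : CosetCat G} (α : B ⟶ A) :
    Function.Injective (associatesMap
      ((ofStable ρ (splitMonoid U (Submonoid.powers θ)) (splitMonoid_stable ρ U θ hU hθ)).pull α)) := by
  set M := ofStable ρ (splitMonoid U (Submonoid.powers θ)) (splitMonoid_stable ρ U θ hU hθ) with hM
  obtain ⟨dA, hdA⟩ := exists_associates_invariants_equiv_nat ρ U θ hU hθ hfree (A.sg : Subgroup G)
  obtain ⟨dB, hdB⟩ := exists_associates_invariants_equiv_nat ρ U θ hU hθ hfree (B.sg : Subgroup G)
  -- `dB ∘ (pull α)^char = dA`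
  have key : ∀ z, dB (associatesMap (M.pull α) z) = dA z := by
    intro z
    obtain ⟨x, rfl⟩ := Associates.mk_surjective z
    obtain ⟨u, hu, _, ⟨n, rfl⟩, hx⟩ := (mem_splitMonoid_iff _ _ _).mp (x : splitMonoid U (Submonoid.powers θ)).2
    rw [associatesMap_mk, hdA x u n hu hx.symm]
    refine hdB (M.pull α x) (ρ (rep α) u) n (hU _ u hu) ?_
    have h1 : (((M.pull α x : M.O) : splitMonoid U (Submonoid.powers θ)) : H) = ρ (rep α) ((x : M.O) : H) := by
      rw [M.coe_pull_eq_act α (rep_spec α)]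
      rfl
    rw [h1, ← hx, map_mul, map_pow, hθ]
  intro z₁ z₂ h
  have := congrArg dB h
  rw [key, key] at this
  exact dA.injective this

/-- `G/V ↦ Ψ^V` of the split `G`-monoid is a monoid on `CosetCat G` ([FrdI] Def 1.1 (ii)).
[cite: MochizukiFrdI2008, Def. 1.1(ii) p.19] -/
theorem isMonoidOn_invariantsFunctor [TopologicalSpace G] [IsTopologicalGroup G] (hfree : ∀ n : ℕ, θ ^ n ∈ U → n = 0) :
    IsMonoidOn (ofStable ρ (splitMonoid U (Submonoid.powers θ)) (splitMonoid_stable ρ U θ hU hθ)).invariantsFunctor :=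
  isMonoidOn_invariantsFunctor_of _ fun α => associatesMap_pull_injective ρ U θ hU hθ hfree α

/-- The divisor monoid `Φ` of the split `G`-monoid is a monoid on `CosetCat G` ([FrdI] Def 1.1 (ii)).
[cite: MochizukiFrdI2008, Def. 1.1(ii) p.19] -/
theorem isMonoidOn_divisorFunctor [TopologicalSpace G] [IsTopologicalGroup G] (hfree : ∀ n : ℕ, θ ^ n ∈ U → n = 0) :
    IsMonoidOn (ofStable ρ (splitMonoid U (Submonoid.powers θ)) (splitMonoid_stable ρ U θ hU hθ)).divisorFunctor :=
  isMonoidOn_divisorFunctor_of _ fun α => associatesMap_pull_injective ρ U θ hU hθ hfree α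

/-- **[FrdI] Thm 5.2 HYPOTHESES for the Frobenioid of [IUTchII] Def 3.8 (ii)** (abc-iut-L1-lead's interface condition (2)): for the
split `G`-monoid `G ↷ U·θ^ℕ` (`U` stable, `θ` fixed, `θ` non-torsion modulo `U`) the data `(Φ, B) = (Ψ/Ψ^×, Ψ^gp)` of
`GMonoidFrobenioids.lean` over `CosetCat G` satisfy `ModelFrobenioid.Hypotheses`: `Φ` a divisorial monoid on the base, `B` a
group-like monoid on the base, base connected and totally epimorphic — so «gives rise to a `p_v`-adic Frobenioid» is an honest
instance of abc-iut-L1-t2's [FrdI] Thm 5.2 model Frobenioid. [cite: Mochizuki2012, Def 3.8 (ii) p.113] -/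
theorem hypotheses_ofStable_splitMonoid [TopologicalSpace G] [IsTopologicalGroup G] (hfree : ∀ n : ℕ, θ ^ n ∈ U → n = 0) :
    ModelFrobenioid.Hypotheses
      (ofStable ρ (splitMonoid U (Submonoid.powers θ)) (splitMonoid_stable ρ U θ hU hθ)).divisorFunctor
      (ofStable ρ (splitMonoid U (Submonoid.powers θ)) (splitMonoid_stable ρ U θ hU hθ)).ratFnFunctor := by
  haveI : IsCancelMul (ofStable ρ (splitMonoid U (Submonoid.powers θ)) (splitMonoid_stable ρ U θ hU hθ)).O :=
    Subtype.coe_injective.isCancelMul _ (fun _ _ => rfl)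
  exact
    { isMonoidOn := isMonoidOn_divisorFunctor ρ U θ hU hθ hfree
      isDivisorial := isDivisorial_divisorFunctor ρ U θ hU hθ hfree
      isMonoidOn_rat := isMonoidOn_ratFnFunctor _
      isGroupLike_rat := isGroupLike_ratFnFunctor _
      isGraphConnected := isGraphConnected_cosetCat
      isTotallyEpimorphic := CosetCat.isTotallyEpimorphic }

end Split

/-! ### §3. At abc-iut-L6-t2's `TemperedThetaMonoids`: the theta monoids `Ψ^ι_env(M^Θ_*)`, `Ψ_{†F^Θ_v,α}` -/
section Instances

variable {P : Type u} [Group P] [TopologicalSpace P] [IsTopologicalGroup P]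

/-- **IUTchII:Def3.8(ii) at `G_v(M^Θ_*▶) ↷ Ψ^ι_env(M^Θ_*)`** (abc-iut-L6-t2's `E : ThetaEnvData P`, `Ψ^ι_env = M^×_TM·θ^ℕ` of
Prop 3.1 (i) at a single class `θ` — w4-d004's `thetaMonoid_eq_splitMonoid_powers` shape; `K ≤ Π_X(M^Θ_*)` stabilising `M^×_TM`,
fixing `θ`; `θ` non-torsion mod `M^×_TM`): `F^ι_env` of `GMonoidFrobenioids` satisfies [FrdI] Thm 5.2's hypotheses AND its divisor
monoid is `ℕ` at every object of `B^temp(K)⁰`. [cite: Mochizuki2012, Def 3.8 (ii) p.113] -/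
theorem def38ii_thetaEnv (E : TemperedThetaMonoids.ThetaEnvData.{u, v} P) (K : Subgroup P) (θ : E.H)
    (hU : ∀ (g : K) (x : E.H), x ∈ E.units → E.conj (g : P) x ∈ E.units) (hθ : ∀ g : K, E.conj (g : P) θ = θ)
    (hfree : ∀ n : ℕ, θ ^ n ∈ E.units → n = 0) :
    ModelFrobenioid.Hypotheses
        (ofStable (E.conj.comp K.subtype) (splitMonoid E.units (Submonoid.powers θ))
          (splitMonoid_stable (E.conj.comp K.subtype) E.units θ (fun g x hx => hU g x hx) (fun g => hθ g))).divisorFunctor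
        (ofStable (E.conj.comp K.subtype) (splitMonoid E.units (Submonoid.powers θ))
          (splitMonoid_stable (E.conj.comp K.subtype) E.units θ (fun g x hx => hU g x hx) (fun g => hθ g))).ratFnFunctor ∧
      ∀ V : Subgroup K, Nonempty
        (Associates ((ofStable (E.conj.comp K.subtype) (splitMonoid E.units (Submonoid.powers θ))
          (splitMonoid_stable (E.conj.comp K.subtype) E.units θ (fun g x hx => hU g x hx) (fun g => hθ g))).invariants V) ≃*
          Multiplicative ℕ) :=
  ⟨hypotheses_ofStable_splitMonoid (E.conj.comp K.subtype) E.units θ (fun g x hx => hU g x hx) (fun g => hθ g) hfree,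
    fun V => ⟨(exists_associates_invariants_equiv_nat (E.conj.comp K.subtype) E.units θ
      (fun g x hx => hU g x hx) (fun g => hθ g) hfree V).choose⟩⟩

/-- **IUTchII:Def3.8(ii) at `G_v(M^Θ_*▶) ↷ Ψ_{†F^Θ_v,α}`** (abc-iut-L6-t2's `F : TemperedFrobenioidThetaData P`, Ex 3.2 (i);
`K ≤ Π_v` stabilising `O^×_{C^Θ_v}`, fixing `Θ^α_v`; `Θ^α_v` non-torsion mod units): `F_{†F^Θ_v,α}` of `GMonoidFrobenioids` satisfies
[FrdI] Thm 5.2's hypotheses and its divisor monoid is `ℕ` at every object. [cite: Mochizuki2012, Def 3.8 (ii) p.113] -/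
theorem def38ii_frobTheta (F : TemperedThetaMonoids.TemperedFrobenioidThetaData.{u, v} P) (α : P) (K : Subgroup P)
    (hU : ∀ (g : K) (x : F.K), x ∈ F.units → F.conj (g : P) x ∈ F.units)
    (hθ : ∀ g : K, F.conj (g : P) (F.conj α F.theta) = F.conj α F.theta)
    (hfree : ∀ n : ℕ, (F.conj α F.theta) ^ n ∈ F.units → n = 0) :
    ModelFrobenioid.Hypotheses
        (ofStable (F.conj.comp K.subtype) (F.frobThetaMonoid α)
          (splitMonoid_stable (F.conj.comp K.subtype) F.units (F.conj α F.theta)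
            (fun g x hx => hU g x hx) (fun g => hθ g))).divisorFunctor
        (ofStable (F.conj.comp K.subtype) (F.frobThetaMonoid α)
          (splitMonoid_stable (F.conj.comp K.subtype) F.units (F.conj α F.theta)
            (fun g x hx => hU g x hx) (fun g => hθ g))).ratFnFunctor ∧
      ∀ V : Subgroup K, Nonempty
        (Associates ((ofStable (F.conj.comp K.subtype) (F.frobThetaMonoid α)
          (splitMonoid_stable (F.conj.comp K.subtype) F.units (F.conj α F.theta)
            (fun g x hx => hU g x hx) (fun g => hθ g))).invariants V) ≃* Multiplicative ℕ) :=
  ⟨hypotheses_ofStable_splitMonoid (F.conj.comp K.subtype) F.units (F.conj α F.theta)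
      (fun g x hx => hU g x hx) (fun g => hθ g) hfree,
    fun V => ⟨(exists_associates_invariants_equiv_nat (F.conj.comp K.subtype) F.units (F.conj α F.theta)
      (fun g x hx => hU g x hx) (fun g => hθ g) hfree V).choose⟩⟩

end Instances

end CoveringMonoid

end Literature.IUT.HodgeArakelov
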